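import Mathlib.GroupTheory.Abelianization.Defs
import Mathlib.LinearAlgebra.Matrix.SpecialLinearGroup
import Mathlib.SetTheory.Cardinal.Basic
import Literature.LinearAlgebra.Matrix.GeneralLinearGroupHomDet
import HarnessLib

/-!
# The abelianization of `GL_n(K)`: `GL_n(K)′ = SL_n(K)` and `GL_n(K) ∕ SL_n(K) ≅ Kˣ` via `det` (`K ≠ 𝔽₂`)

Topic `LinearAlgebra/Matrix`; namespace `Literature.LinearAlgebra.Matrix.GLAbelianization`.  KERNEL only (theorems, no
definition, no notation, no instance, no named fact, no `sorry`).  Sequel of ✔ `GeneralLinearGroupHomDet`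
(`GLHomDet.apply_eq_one_of_det_eq_one`: for a field `K` with an element `a ∉ {0, 1}` every homomorphism `GL n K →* A` to a
commutative group kills `{det = 1}`, [Artin1988, Chap. IV Thm. 4.6]), which it turns into the structure theorem it implies
[Dieudonne1971GroupesClassiques, Chap. II §1: `SL_n(K)` is the commutator subgroup of `GL_n(K)` for a commutative field `K`,
except `n = 2`, `K = 𝔽₂`] — the general-linear counterpart of ✔ `NumberTheory/Automorphic/UnitaryIsotropicAbelianization`:

* §1 **`commutator_eq_ker_det`** — `commutator (GL n K) = ker det` for EVERY finite index type `n` and every field `K` with an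
  element `a ∉ {0, 1}` (`≤`: `Kˣ` is commutative; `≥`: ✔ `GLHomDet` applied to the canonical map `GL n K → (GL n K)^{ab}`);
  membership forms **`mem_commutator_iff_det_eq_one`**, `mem_commutator_iff_val_det_eq_one`, **`toGL_mem_commutator`**
  (`SL_n(K) ≤ GL_n(K)′`), **`commutator_eq_range_toGL`** (`GL_n(K)′ = toGL(SL_n(K))`).  For `n = 2` the hypothesis `K ≠ 𝔽₂` is necessary: `GL₂(𝔽₂) ≅ S₃` has trivial `det` but is not perfect
  (✔ `Literature.RepresentationTheory.GL2F2.commutator_ne_top`).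
* §2 **`existsUnique_eq_comp_det`** — every homomorphism `χ : GL n K →* A` to a commutative group is `ψ ∘ det` for a UNIQUE
  `ψ : Kˣ →* A` (`n` non-empty; `det` is onto, Mathlib `Matrix.GeneralLinearGroup.det_surjective`) — «characters of `GL_n(K)` are
  `χ ∘ det`»; **`bijective_abelianizationLift_det`** — `(GL n K)^{ab} → Kˣ`, `[g] ↦ det g`, is a group ISOMORPHISM.
* §3 the hypothesis `K ≠ 𝔽₂`: `exists_ne_zero_and_ne_one_of_two_ne_zero` (characteristic `≠ 2`), `…_of_infinite` (e.g. local and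
  global fields), `…_of_two_lt_card`; and the `2 ≠ 0` ∕ infinite-field specialisations of §1–§2.

Written for the pub-hodgecm2 (COR-CM) audit of [Liu2021, App. D Lemma D.1 (3)] at SPLIT places, where `U(V)(F_v) ≅ GL_N(E_w)`
(seat prover-pub-hodgecm2-b10); nothing here is specific to local fields.  HC_CM is NOT proved.

## References

* E. Artin, *Geometric Algebra*, Interscience (1957), Chap. IV Thm. 4.6 [Artin1988].
* J. Dieudonné, *La géométrie des groupes classiques*, 3e éd., Springer (1971), Chap. II §1 [Dieudonne1971GroupesClassiques].
-/

set_option autoImplicit false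

open scoped MatrixGroups

namespace Literature.LinearAlgebra.Matrix

namespace GLAbelianization

variable {K : Type*} [Field K] {n : Type*} [Fintype n] [DecidableEq n]

/-! ## §0 Pure group theory (private): `commutator G = ker f` from a kills property, and its consequences -/

section GroupTheory

variable {G M A : Type*} [Group G] [CommGroup M] [CommGroup A]

/-- `commutator G = ker f` as soon as `ker f` dies in `G^{ab}` (the other inclusion holds because `M` is commutative). [folklore] -/
private theorem commutator_eq_ker_of_kills (f : G →* M)
    (h : ∀ g : G, f g = 1 → (Abelianization.of g : Abelianization G) = 1) : commutator G = f.ker := by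
  refine le_antisymm (Abelianization.commutator_subset_ker f) fun g hg => ?_
  have key := h g ((MonoidHom.mem_ker).1 hg)
  rwa [← MonoidHom.mem_ker, Abelianization.ker_of] at key

/-- From `commutator G = ker f` with `f` onto: every homomorphism to a commutative group is `ψ ∘ f` for a UNIQUE `ψ`. [folklore] -/
private theorem existsUnique_eq_comp_of_commutator_eq (f : G →* M) (hc : commutator G = f.ker)
    (hf : Function.Surjective f) (χ : G →* A) : ∃! ψ : M →* A, χ = ψ.comp f := by
  have hker : f.ker ≤ χ.ker := by
    rw [← hc]
    exact Abelianization.commutator_subset_ker χ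
  refine ⟨MonoidHom.liftOfSurjective f hf ⟨χ, hker⟩, ?_, fun ψ hψ => ?_⟩
  · exact (MonoidHom.liftOfRightInverse_comp f (Function.surjInv hf) (Function.rightInverse_surjInv hf) ⟨χ, hker⟩).symm
  · ext y
    obtain ⟨g, rfl⟩ := hf y
    rw [MonoidHom.liftOfRightInverse_comp_apply]
    exact (congrArg (fun φ : G →* A => φ g) hψ).symm

/-- From `commutator G = ker f` with `f` onto: `G^{ab} → M`, `[g] ↦ f g`, is bijective. [folklore] -/
private theorem bijective_lift_of_commutator_eq (f : G →* M) (hc : commutator G = f.ker) (hf : Function.Surjective f) :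
    Function.Bijective (Abelianization.lift f) := by
  have hofs : Function.Surjective (Abelianization.of : G →* Abelianization G) :=
    fun x => QuotientGroup.induction_on x fun g => ⟨g, rfl⟩
  constructor
  · rw [← MonoidHom.ker_eq_bot_iff, eq_bot_iff]
    intro x hx
    obtain ⟨g, rfl⟩ := hofs x
    rw [MonoidHom.mem_ker, Abelianization.lift_apply_of] at hx
    have hg : g ∈ f.ker := (MonoidHom.mem_ker).2 hx
    rw [← hc, ← Abelianization.ker_of] at hg
    rw [Subgroup.mem_bot]
    exact (MonoidHom.mem_ker).1 hg
  · intro y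
    obtain ⟨g, rfl⟩ := hf y
    exact ⟨Abelianization.of g, Abelianization.lift_apply_of _ _⟩

end GroupTheory

/-! ## §1 `GL_n(K)′ = SL_n(K)` -/

/-- **`GL_n(K)′ = SL_n(K)`** — for a field `K` with an element `a ∉ {0, 1}` (i.e. `K ≠ 𝔽₂`) and ANY finite index type `n`, the
commutator subgroup of `GL n K` is the kernel of `det : GL n K →* Kˣ` (`≤`: `Kˣ` is commutative; `≥`: every homomorphism to a commutative
group kills `{det = 1}`, ✔ `GLHomDet.apply_eq_one_of_det_eq_one`, applied to `GL n K → (GL n K)^{ab}`).  For `n = 2` the hypothesis `K ≠ 𝔽₂`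
is necessary (`GL₂(𝔽₂) ≅ S₃`). [cite: Dieudonne1971GroupesClassiques, Chap. II §1] [cite: Artin1988, Chap. IV Thm. 4.6] -/
theorem commutator_eq_ker_det (hK : ∃ a : K, a ≠ 0 ∧ a ≠ 1) :
    commutator (GL n K) = (Matrix.GeneralLinearGroup.det : GL n K →* Kˣ).ker :=
  commutator_eq_ker_of_kills _ fun _ hg => GLHomDet.apply_eq_one_of_det_eq_one hK Abelianization.of hg

/-- **Membership form: `g ∈ GL_n(K)′ ↔ det g = 1`** (`Kˣ`-valued determinant). [cite: Dieudonne1971GroupesClassiques, Chap. II §1] -/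
theorem mem_commutator_iff_det_eq_one (hK : ∃ a : K, a ≠ 0 ∧ a ≠ 1) (g : GL n K) :
    g ∈ commutator (GL n K) ↔ Matrix.GeneralLinearGroup.det g = 1 := by
  rw [commutator_eq_ker_det hK, MonoidHom.mem_ker]

/-- Membership form with the matrix determinant: `g ∈ GL_n(K)′ ↔ det (g : Matrix) = 1`. [cite: Dieudonne1971GroupesClassiques, Chap. II §1] -/
theorem mem_commutator_iff_val_det_eq_one (hK : ∃ a : K, a ≠ 0 ∧ a ≠ 1) (g : GL n K) :
    g ∈ commutator (GL n K) ↔ (g : Matrix n n K).det = 1 := by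
  rw [mem_commutator_iff_det_eq_one hK, ← Matrix.GeneralLinearGroup.val_det_apply, Units.val_eq_one]

/-- **`SL_n(K) ≤ GL_n(K)′`**: every matrix of determinant one is a product of commutators of `GL_n(K)` (`K ≠ 𝔽₂`).
[cite: Dieudonne1971GroupesClassiques, Chap. II §1] [cite: Artin1988, Chap. IV Thm. 4.6] -/
theorem toGL_mem_commutator (hK : ∃ a : K, a ≠ 0 ∧ a ≠ 1) (g : Matrix.SpecialLinearGroup n K) :
    Matrix.SpecialLinearGroup.toGL g ∈ commutator (GL n K) :=
  (mem_commutator_iff_val_det_eq_one hK _).2 g.2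

/-- In particular every elementary matrix `x_{ij}(c) = 1 + c E_{ij}` lies in `GL_n(K)′` (`K ≠ 𝔽₂`).
[cite: Artin1988, Chap. IV Thm. 4.6] -/
theorem toGL_transvection_mem_commutator (hK : ∃ a : K, a ≠ 0 ∧ a ≠ 1) {i j : n} (hij : i ≠ j) (c : K) :
    Matrix.SpecialLinearGroup.toGL (Matrix.SpecialLinearGroup.transvection hij c) ∈ commutator (GL n K) :=
  toGL_mem_commutator hK _

/-- **`GL_n(K)′ = SL_n(K)` as the image of `Matrix.SpecialLinearGroup.toGL`**: `commutator (GL n K) = range (toGL : SL n K →* GL n K)`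
(`K ≠ 𝔽₂`; the form in which the tree's ✔ `ProjectiveSpecialLinearGroupSimple` speaks of `SL_n ≤ GL_n`).
[cite: Dieudonne1971GroupesClassiques, Chap. II §1] [cite: Artin1988, Chap. IV Thm. 4.6] -/
theorem commutator_eq_range_toGL (hK : ∃ a : K, a ≠ 0 ∧ a ≠ 1) :
    commutator (GL n K) = (Matrix.SpecialLinearGroup.toGL : Matrix.SpecialLinearGroup n K →* GL n K).range := by
  ext g
  rw [mem_commutator_iff_val_det_eq_one hK]
  constructor
  · intro hg
    exact ⟨⟨(g : Matrix n n K), hg⟩, Units.ext rfl⟩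
  · rintro ⟨s, rfl⟩
    exact s.2

/-! ## §2 Characters of `GL_n(K)`: unique factorisation through `det`; `GL_n(K)^{ab} ≅ Kˣ` -/

/-- **«Characters of `GL_n(K)` are `ψ ∘ det`»**: every homomorphism `χ : GL n K →* A` to a commutative group is `ψ ∘ det` for a UNIQUE
homomorphism `ψ : Kˣ →* A` (`n` non-empty, `K ≠ 𝔽₂`; `det` is onto, Mathlib `Matrix.GeneralLinearGroup.det_surjective`).
[cite: Dieudonne1971GroupesClassiques, Chap. II §1] [cite: Artin1988, Chap. IV Thm. 4.6] -/
theorem existsUnique_eq_comp_det {A : Type*} [CommGroup A] [Nonempty n] (hK : ∃ a : K, a ≠ 0 ∧ a ≠ 1) (χ : GL n K →* A) :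
    ∃! ψ : Kˣ →* A, χ = ψ.comp Matrix.GeneralLinearGroup.det :=
  existsUnique_eq_comp_of_commutator_eq _ (commutator_eq_ker_det hK) Matrix.GeneralLinearGroup.det_surjective χ

/-- **`GL_n(K)^{ab} ≅ Kˣ`**: the homomorphism `(GL n K)^{ab} → Kˣ`, `[g] ↦ det g` (`Abelianization.lift det`), is BIJECTIVE (`n` non-empty,
`K ≠ 𝔽₂`). [cite: Dieudonne1971GroupesClassiques, Chap. II §1] -/
theorem bijective_abelianizationLift_det [Nonempty n] (hK : ∃ a : K, a ≠ 0 ∧ a ≠ 1) :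
    Function.Bijective (Abelianization.lift (Matrix.GeneralLinearGroup.det : GL n K →* Kˣ)) :=
  bijective_lift_of_commutator_eq _ (commutator_eq_ker_det hK) Matrix.GeneralLinearGroup.det_surjective

/-! ## §3 The hypothesis `K ≠ 𝔽₂` -/

omit [Fintype n] [DecidableEq n] in
/-- In characteristic `≠ 2` the element `a = 2` serves (`2 ≠ 0, 1`) — the hypothesis `K ≠ 𝔽₂` of §1.
[cite: Dieudonne1971GroupesClassiques, Chap. II §1] -/
theorem exists_ne_zero_and_ne_one_of_two_ne_zero (h2 : (2 : K) ≠ 0) : ∃ a : K, a ≠ 0 ∧ a ≠ 1 :=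
  ⟨2, h2, fun h => one_ne_zero (α := K) (by linear_combination h)⟩

omit [Fintype n] [DecidableEq n] in
/-- In an infinite field (every local field, every number field) some `a ∉ {0, 1}` exists — the hypothesis `K ≠ 𝔽₂` of §1.
[cite: Dieudonne1971GroupesClassiques, Chap. II §1] -/
theorem exists_ne_zero_and_ne_one_of_infinite [Infinite K] : ∃ a : K, a ≠ 0 ∧ a ≠ 1 := by
  obtain ⟨a, ha⟩ := (Set.toFinite ({0, 1} : Set K)).infinite_compl.nonempty
  simp only [Set.mem_compl_iff, Set.mem_insert_iff, Set.mem_singleton_iff, not_or] at ha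
  exact ⟨a, ha.1, ha.2⟩

omit [Fintype n] [DecidableEq n] in
/-- A field with more than two elements has some `a ∉ {0, 1}` — the hypothesis `K ≠ 𝔽₂` of §1 from `2 < #K`.
[cite: Dieudonne1971GroupesClassiques, Chap. II §1] -/
theorem exists_ne_zero_and_ne_one_of_two_lt_card (hK : 2 < Cardinal.mk K) : ∃ a : K, a ≠ 0 ∧ a ≠ 1 := by
  by_contra h
  push Not at h
  have hsub : (Set.univ : Set K) ⊆ {0, 1} := fun a _ => by
    by_cases ha : a = 0
    · exact Or.inl ha
    · exact Or.inr (h a ha)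
  have hle : Cardinal.mk K ≤ 2 := by
    rw [← Cardinal.mk_univ]
    refine (Cardinal.mk_le_mk_of_subset hsub).trans ?_
    refine (Cardinal.mk_insert_le).trans ?_
    rw [Cardinal.mk_singleton]
    norm_num
  exact not_lt.2 hle hK

/-- `GL_n(K)′ = SL_n(K)` for a field with `2 ≠ 0` (e.g. characteristic zero). [cite: Dieudonne1971GroupesClassiques, Chap. II §1] -/
theorem commutator_eq_ker_det_of_two_ne_zero (h2 : (2 : K) ≠ 0) :
    commutator (GL n K) = (Matrix.GeneralLinearGroup.det : GL n K →* Kˣ).ker :=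
  commutator_eq_ker_det (exists_ne_zero_and_ne_one_of_two_ne_zero h2)

/-- `g ∈ GL_n(K)′ ↔ det g = 1` for a field with `2 ≠ 0`. [cite: Dieudonne1971GroupesClassiques, Chap. II §1] -/
theorem mem_commutator_iff_val_det_eq_one_of_two_ne_zero (h2 : (2 : K) ≠ 0) (g : GL n K) :
    g ∈ commutator (GL n K) ↔ (g : Matrix n n K).det = 1 :=
  mem_commutator_iff_val_det_eq_one (exists_ne_zero_and_ne_one_of_two_ne_zero h2) g

/-- Every `χ : GL n K →* A` is `ψ ∘ det` for a unique `ψ`, for a field with `2 ≠ 0`. [cite: Dieudonne1971GroupesClassiques, Chap. II §1] -/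
theorem existsUnique_eq_comp_det_of_two_ne_zero {A : Type*} [CommGroup A] [Nonempty n] (h2 : (2 : K) ≠ 0)
    (χ : GL n K →* A) : ∃! ψ : Kˣ →* A, χ = ψ.comp Matrix.GeneralLinearGroup.det :=
  existsUnique_eq_comp_det (exists_ne_zero_and_ne_one_of_two_ne_zero h2) χ

/-- `(GL n K)^{ab} → Kˣ` is bijective, for a field with `2 ≠ 0`. [cite: Dieudonne1971GroupesClassiques, Chap. II §1] -/
theorem bijective_abelianizationLift_det_of_two_ne_zero [Nonempty n] (h2 : (2 : K) ≠ 0) :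
    Function.Bijective (Abelianization.lift (Matrix.GeneralLinearGroup.det : GL n K →* Kˣ)) :=
  bijective_abelianizationLift_det (exists_ne_zero_and_ne_one_of_two_ne_zero h2)

/-- `GL_n(K)′ = SL_n(K)` for an infinite field. [cite: Dieudonne1971GroupesClassiques, Chap. II §1] -/
theorem commutator_eq_ker_det_of_infinite [Infinite K] :
    commutator (GL n K) = (Matrix.GeneralLinearGroup.det : GL n K →* Kˣ).ker :=
  commutator_eq_ker_det exists_ne_zero_and_ne_one_of_infinite

/-- Every `χ : GL n K →* A` is `ψ ∘ det` for a unique `ψ`, for an infinite field (every local field).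
[cite: Dieudonne1971GroupesClassiques, Chap. II §1] -/
theorem existsUnique_eq_comp_det_of_infinite {A : Type*} [CommGroup A] [Nonempty n] [Infinite K] (χ : GL n K →* A) :
    ∃! ψ : Kˣ →* A, χ = ψ.comp Matrix.GeneralLinearGroup.det :=
  existsUnique_eq_comp_det exists_ne_zero_and_ne_one_of_infinite χ

end GLAbelianization

end Literature.LinearAlgebra.Matrix
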